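import Literature.Analysis.FluidPDE.PassiveScalarVelocityStability
import Literature.Analysis.FluidPDE.PassiveVector
import HarnessLib

/-!
# K3′ `K3NonlinearClosure` (aside, stmt-AnomalousDissipation-20027), line `Localised` — STUB S2a
# `stub_scalarVelocityStability`

Registered stub `stub_scalarVelocityStability` of the line `Localised` (reshape r2: the first conjunct of the former
conjunction stub `stub_toolkit`, the predicate `ScalarVelocityStability` spelled out): `L²`-stability of classical
scalar transport on `𝕋²` under a drift perturbation,
`|‖θ(T)‖² − ‖ζ(T)‖²| ≤ 2‖θ(0)‖ ∫₀ᵀ ‖(u − v)(t)‖_{L²} G(t) dt` for two classical solutions with the same datum and any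
gradient bound `‖∇θ(t,·)‖ ≤ G(t)`.  It IS the tree theorem
`Torus.IsClassicalScalarTransportOn.scalarVelocityStability` (`PassiveScalarVelocityStability`, Bruè–De Lellis 2023 §9
Lemma 7, scalar twin) at `d = Fin 2`: a citation.  No new definitions, no named facts.
-/

-- `Summit.<Summit>.<Problem>`: single-conjunct summit, the duplicate namespace segment is deliberate.
set_option linter.dupNamespace false

noncomputable section

namespace Summit.AnomalousDissipation.AnomalousDissipation.Theorems.SawtoothPulseCascade.K3NonlinearClosureLocalised

open MeasureTheory Set
open Literature.Analysis Literature.Analysis.FluidPDE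

/-- **STUB S2a `stub_scalarVelocityStability`** of line `Localised` of the aside `K3NonlinearClosure`
(stmt-AnomalousDissipation-20027): the tree theorem `Torus.IsClassicalScalarTransportOn.scalarVelocityStability` at
`d = Fin 2`. [cite: BrueDeLellisCMP2023, §9 Lemma 7 (scalar twin of the velocity comparison)] -/
theorem stub_scalarVelocityStability :
    ∀ (S : Set ℝ) (κ T : ℝ) (u v : ℝ → UnitAddTorus (Fin 2) → EuclideanSpace ℝ (Fin 2))
      (θ ζ : ℝ → UnitAddTorus (Fin 2) → ℝ) (G : ℝ → ℝ),
      0 ≤ κ → 0 ≤ T → Convex ℝ S → Icc 0 T ⊆ S →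
      FluidPDE.Torus.IsClassicalScalarTransportOn S κ u θ → FluidPDE.Torus.IsClassicalScalarTransportOn S κ v ζ →
      θ 0 = ζ 0 →
      (∀ t ∈ Icc 0 T, ∀ x, ‖FunctionSpaces.Torus.gradient (θ t) x‖ ≤ G t) →
      IntervalIntegrable (fun t => Real.sqrt (FluidPDE.Torus.vectorL2Sq (u t - v t)) * G t) volume 0 T →
      |FluidPDE.Torus.scalarL2Sq (θ T) - FluidPDE.Torus.scalarL2Sq (ζ T)| ≤
        2 * Real.sqrt (FluidPDE.Torus.scalarL2Sq (θ 0)) *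
          ∫ t in (0 : ℝ)..T, Real.sqrt (FluidPDE.Torus.vectorL2Sq (u t - v t)) * G t :=
  fun S κ T u v θ ζ G => FluidPDE.Torus.IsClassicalScalarTransportOn.scalarVelocityStability S κ T u v θ ζ G

end Summit.AnomalousDissipation.AnomalousDissipation.Theorems.SawtoothPulseCascade.K3NonlinearClosureLocalised

end
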